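import Summits.QuantumFields.YangMills.Theses.LuscherReduction
import Summits.QuantumFields.YangMills.Theorems.FemtoTransferGapBounds
import Summits.QuantumFields.YangMills.Theorems.LuscherReductionOneSiteLevelsVariational
import Summits.QuantumFields.YangMills.Theorems.LuscherReductionOneSiteLevelsPhase
import Summits.QuantumFields.YangMills.Theorems.LuscherReductionOneSiteLevelsValleySeam
import Summits.QuantumFields.YangMills.Theorems.LuscherReductionOneSiteLevelsAbsLower
import Summits.QuantumFields.YangMills.Theorems.LuscherReductionOneSiteLevelsKacInner
import Summits.QuantumFields.YangMills.Theorems.LuscherReductionOneSiteLevelsKacFlat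
import Summits.QuantumFields.YangMills.Theorems.LuscherReductionOneSiteLevelsValleyMain
import Summits.QuantumFields.YangMills.Theorems.FemtoTransferGapReduction
import Literature.Analysis.OperatorTheory.YangMillsMatrixModelEigenfunctions

/-!
# Crux ONE `OneSiteLevels` (route `LuscherReduction`, item stmt-QuantumFields-20007) CLOSED MODULO THE NAMED FACT AL1
# (fleet lead prover ym-luscher-20007-p1 g2; composition of line `birth`, skeleton v13/v14)

With the three analytic stubs of the line `birth` now theorems of the tree —
INNER = `innerOfFlatKac` (p484690, lattice lane) ∘ `flatKac_of_AL1` (p492332, flat lane), VALLEY = `oneSiteAbsUpperValleyMag` (p492536, this seat)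
↦ OUTER by the seam `absUpperOuter_of_valleyMag` (p449656), LOWER = `oneSiteAbsLower_of_eigenfunctions` (p469541) — the kernel-checked
composition of the skeleton (`absUpper_of_inner_outer`, `oneSite_energyLower_of_abs` / `oneSite_energyUpper_of_abs`, `oneSiteTopPos`) yields
the crux statement `Summit.QuantumFields.YangMills.Theses.LuscherReduction.OneSiteLevels` from the single printed-theorem hypothesis
AL1 = `∀ k, LuscherHamiltonianEigenfunctions k` (eigenfunctions of Lüscher's matrix Hamiltonian `𝔥 = −½Δ + ¼Σ|x_i × x_j|²` realising the
min–max levels; [ReedSimonIV1978, Thm. XIII.64], [Agmon1982], reviewed Literature definition, NOT proved in the tree).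

`oneSiteLevels_of_AL1 : (∀ k, LuscherHamiltonianEigenfunctions k) → OneSiteLevels` — a CONDITIONAL result: the crux item stays open until
AL1 is formalised (or the route is re-typed to carry AL1 as a hypothesis); nothing else on the composition path is open.

## WHAT THIS IS NOT
Conditional on AL1; NOT an unconditional proof of the crux, NOT `LuscherBridge`, NOT THE CLAY GAP.  Sorry-free; no new definition, no new fact.
-/

set_option autoImplicit false

noncomputable section

open MeasureTheory Filter Topology Real
open Literature.MathematicalPhysics.QuantumFieldTheory
open Literature.MathematicalPhysics.QuantumLattice
open Literature.Analysis.OperatorTheory.YMMatrixModel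

namespace Summit.QuantumFields.YangMills.Theorems.FemtoTransferGap

/-- **Absolute upper bounds for all one-site levels, modulo AL1**: `μ_k(B) ≤ linkC(B)³ e^{−E_{k+1}λ_b + Cλ_b²}` (INNER ∘ FLAT, VALLEY ↦ OUTER,
glued by `absUpper_of_inner_outer`). [cite: SimonB1983DiscreteSpectrum, §2] [cite: Luscher1983, §2] -/
theorem oneSiteAbsUpper_of_AL1 (hAL1 : ∀ k : ℕ, LuscherHamiltonianEigenfunctions k) (k : ℕ) :
    ∃ C B0 : ℝ, ∀ B : ℝ, B0 ≤ B →
      levelValue su2Rep 1 B k ≤ linkC B ^ 3 * Real.exp (-(physLevel (k + 1) * bareLambda B) + C * bareLambda B ^ 2) := by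
  refine absUpper_of_inner_outer k (innerOfFlatKac k (flatKac_of_AL1 hAL1 k)) ?_
  obtain ⟨C₁, B₁, hB₁, h⟩ := oneSiteAbsUpperValleyMag k
  exact absUpperOuter_of_valleyMag k hB₁ h

/-- **CRUX ONE MODULO AL1.**  The one-site transfer-operator levels `μ_k(B)` satisfy `OneSiteLevels` — positivity of `μ₀` and the two-sided
asymptotics `μ_k/μ₀ = e^{−ΔE_k λ_b ± Cλ_b²}` — provided Lüscher's matrix Hamiltonian has its textbook eigenfunctions (AL1).
[cite: Luscher1983, §2] [cite: SimonB1983DiscreteSpectrum, §2] [cite: ReedSimonIV1978, Thm. XIII.64] -/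
theorem oneSiteLevels_of_AL1 (hAL1 : ∀ k : ℕ, LuscherHamiltonianEigenfunctions k) :
    Summit.QuantumFields.YangMills.Theses.LuscherReduction.OneSiteLevels := by
  show ∀ k : ℕ, ∃ C B0 : ℝ, ∀ B : ℝ, B0 ≤ B → 0 < levelValue su2Rep 1 B 0 ∧
      levelValue su2Rep 1 B k ≤ Real.exp (-(levelGap k * bareLambda B - C * bareLambda B ^ 2)) * levelValue su2Rep 1 B 0 ∧
        Real.exp (-(levelGap k * bareLambda B + C * bareLambda B ^ 2)) * levelValue su2Rep 1 B 0 ≤ levelValue su2Rep 1 B k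
  have hup := oneSiteAbsUpper_of_AL1 hAL1
  have hlow : ∀ k : ℕ, ∃ C B0 : ℝ, ∀ B : ℝ, B0 ≤ B →
      linkC B ^ 3 * Real.exp (-(physLevel (k + 1) * bareLambda B) - C * bareLambda B ^ 2) ≤ levelValue su2Rep 1 B k :=
    fun k => oneSiteAbsLower_of_eigenfunctions (hAL1 k)
  have h₂ := oneSite_energyLower_of_abs (fun B => linkC B ^ 3) hup (hlow 0)
  have h₃ := oneSite_energyUpper_of_abs (fun B => linkC B ^ 3) hlow (hup 0)
  intro k
  obtain ⟨C₂, B₂, H₂⟩ := h₂ k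
  obtain ⟨C₃, B₃, H₃⟩ := h₃ k
  refine ⟨max C₂ C₃, max (max B₂ B₃) 1, fun B hB => ?_⟩
  have hB2 : B₂ ≤ B := ((le_max_left B₂ B₃).trans (le_max_left _ _)).trans hB
  have hB3 : B₃ ≤ B := ((le_max_right B₂ B₃).trans (le_max_left _ _)).trans hB
  have hB1 : 1 ≤ B := (le_max_right _ _).trans hB
  have hpos : 0 < levelValue su2Rep 1 B 0 := oneSiteTopPos B hB1
  have ht : 0 ≤ bareLambda B ^ 2 := sq_nonneg _
  refine ⟨hpos, ?_, ?_⟩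
  · have hexp : Real.exp (-(levelGap k * bareLambda B - C₂ * bareLambda B ^ 2)) ≤
        Real.exp (-(levelGap k * bareLambda B - max C₂ C₃ * bareLambda B ^ 2)) := by
      apply Real.exp_le_exp.mpr
      have := mul_le_mul_of_nonneg_right (le_max_left C₂ C₃) ht
      linarith
    exact (H₂ B hB2).trans (mul_le_mul_of_nonneg_right hexp hpos.le)
  · have hexp : Real.exp (-(levelGap k * bareLambda B + max C₂ C₃ * bareLambda B ^ 2)) ≤
        Real.exp (-(levelGap k * bareLambda B + C₃ * bareLambda B ^ 2)) := by
      apply Real.exp_le_exp.mpr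
      have := mul_le_mul_of_nonneg_right (le_max_right C₂ C₃) ht
      linarith
    exact (mul_le_mul_of_nonneg_right hexp hpos.le).trans (H₃ B hB3)

/-- **The registered PLAN-ONLY rung `stub_rungK1 : FemtoGapOneSite` (the tree's one-site leaf, `k = 1`, one-sided), MODULO AL1** — from the
conditional crux by the landed implication `femtoGapOneSite_of_oneSiteLevels`. [cite: Luscher1983, §2] -/
theorem femtoGapOneSite_of_AL1 (hAL1 : ∀ k : ℕ, LuscherHamiltonianEigenfunctions k) : FemtoGapOneSite :=
  femtoGapOneSite_of_oneSiteLevels (oneSiteLevels_of_AL1 hAL1)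

end Summit.QuantumFields.YangMills.Theorems.FemtoTransferGap

end
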